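import Summits.QuantumFields.YangMills.Theorems.SwapVirialDeficitZeroModeGroupThreeSmallBallRateHub
import HarnessLib

/-!
# The cone measure in the coordinates `(a₀, ‖Im a‖²)` — radial disintegration of hub integrals
# (free-hands support of ⟨stmt-QuantumFields-24197⟩ / ⟨24497⟩; input R4 of the K4 two-scale programme `…ZeroModeGroupFourSmallBall*`)

Every hub integral of the zero-mode rung (K3: ✓`haar_tripleBall_eq_scaled`; K4: ✓`haar_nearlyCommuting_eq_twoScale`; the polar caps of
✓`…SmallBallRateHub`) integrates a function of `(a₀, ‖Im a‖)` only against ✓`ToronLog.coneMeasure`.  This file records the disintegration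
★★ `lintegral_coneMeasure_re_normSqIm` :
`∫ F(a₀, ‖Im a‖²) dcone(a) = coneConst · ∫_ℝ da₀ · 4π ∫_{ρ>0} ρ² · 𝟙{a₀² + ρ² < 1} · F(a₀, ρ²) dρ`
(✓`lintegral_coneMeasure_eq`, ✓`measurePreserving_quatReImEquiv`, Tonelli, and w3 g62's ✓`ZeroModeExact.lintegral_chart_radial` on `ℝ³`), and the
total-mass corollary `coneConst·4π·∫∫ = 1`.  For the K4 logarithm law this turns the weight `(‖a‖/4‖Im a‖)³` of the two-scale formula into
`(a₀² + ρ²)^{3/2}/(64ρ³)·4πρ² dρ = (π/16)(a₀² + ρ²)^{3/2} dρ/ρ` — the `dρ/ρ` of the logarithm.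
HONEST LABEL: finite-dimensional measure theory; NOT ⟨24497⟩, NOT ⟨24197⟩; the Yang–Mills mass gap is NOT proved; no summit is proved by a line.
Seat ym-line-fcl-p3 g44 (cell ym-idea-1, free hands), `--supports stmt-QuantumFields-24197`.  THEOREMS ONLY, standard axioms.
References: [cite: GonzalezarroyoAltes1988]; [cite: Vanbaal2001]; [folklore].
-/

set_option autoImplicit false

noncomputable section

open MeasureTheory Quaternion Set
open scoped Quaternion ENNReal BigOperators
open Literature.MathematicalPhysics.QuantumLattice
open Summit.QuantumFields.YangMills.Theorems.SwapTwistDeficit.ToronLog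
open Summit.QuantumFields.YangMills.Theorems.ToronValleyVolume.NearlyCommutingCeiling (sq_norm_im_eq)
open Summit.QuantumFields.YangMills.Theorems.SwapVirialDeficit.ZeroModeExact (lintegral_chart_radial)

attribute [local instance] Literature.Analysis.FluidPDE.Tao2016.quatMeasurableSpace
  Literature.Analysis.FluidPDE.Tao2016.quatBorelSpace
  Literature.MathematicalPhysics.QuantumLattice.secondCountableTopology_su2

namespace Summit.QuantumFields.YangMills.Theorems.SwapVirialDeficit.ZeroModeGroup

/-- The integrand in the coordinates `(a₀, v) ∈ ℝ × ℝ³` of ✓`quatReImEquiv`: `𝟙{a₀² + Σvᵢ² < 1}·F(a₀, Σvᵢ²)`. [folklore] -/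
def coneCoordFun (F : ℝ → ℝ → ℝ≥0∞) (p : ℝ × (Fin 3 → ℝ)) : ℝ≥0∞ :=
  {q : ℝ × ℝ | q.1 ^ 2 + q.2 < 1}.indicator (fun q => F q.1 q.2) (p.1, ∑ i, p.2 i ^ 2)

/-- `coneCoordFun F` is measurable for jointly measurable `F`. [folklore] -/
theorem measurable_coneCoordFun {F : ℝ → ℝ → ℝ≥0∞} (hF : Measurable (Function.uncurry F)) : Measurable (coneCoordFun F) := by
  have hs : Measurable fun p : ℝ × (Fin 3 → ℝ) => ∑ i, p.2 i ^ 2 :=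
    Finset.measurable_sum _ fun i _ => ((measurable_pi_apply i).comp measurable_snd).pow_const 2
  have hq : Measurable fun p : ℝ × (Fin 3 → ℝ) => (p.1, ∑ i, p.2 i ^ 2) := measurable_fst.prodMk hs
  have hind : Measurable ({q : ℝ × ℝ | q.1 ^ 2 + q.2 < 1}.indicator (fun q : ℝ × ℝ => F q.1 q.2)) :=
    Measurable.indicator hF (measurableSet_lt ((measurable_fst.pow_const 2).add measurable_snd) measurable_const)
  exact hind.comp hq

/-- The ball indicator in the coordinates: `𝟙_B(a)·F(a₀, ‖Im a‖²) = coneCoordFun F (quatReImEquiv a)`. [folklore] -/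
theorem ball_indicator_eq_coneCoordFun (F : ℝ → ℝ → ℝ≥0∞) (a : ℍ) :
    (Metric.ball (0 : ℍ) 1).indicator (fun a => F a.re (‖a.im‖ ^ 2)) a = coneCoordFun F (quatReImEquiv a) := by
  have hsum : ∑ i, ((quatReImEquiv a).2 i) ^ 2 = ‖a.im‖ ^ 2 := (sq_norm_im_eq_sum a).symm
  have hre : (quatReImEquiv a).1 = a.re := by rw [quatReImEquiv_apply]
  have hball : a ∈ Metric.ball (0 : ℍ) 1 ↔ a.re ^ 2 + ‖a.im‖ ^ 2 < 1 := by
    rw [Metric.mem_ball, dist_zero_right, sq_norm_im_eq]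
    constructor
    · intro h; nlinarith [norm_nonneg a]
    · intro h; nlinarith [norm_nonneg a]
  unfold coneCoordFun
  rw [hsum, hre]
  by_cases h : a ∈ Metric.ball (0 : ℍ) 1
  · rw [Set.indicator_of_mem h, Set.indicator_of_mem (show (a.re, ‖a.im‖ ^ 2) ∈ {q : ℝ × ℝ | q.1 ^ 2 + q.2 < 1} from hball.1 h)]
  · rw [Set.indicator_of_notMem h, Set.indicator_of_notMem (show (a.re, ‖a.im‖ ^ 2) ∉ {q : ℝ × ℝ | q.1 ^ 2 + q.2 < 1} from fun h' => h (hball.2 h'))]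

/-- ★★ **RADIAL DISINTEGRATION OF THE CONE MEASURE**: for jointly measurable `F : ℝ → ℝ → ℝ≥0∞`,
`∫ F(a₀, ‖Im a‖²) dcone(a) = coneConst · ∫ da₀ (4π · ∫_{ρ>0} ρ² · 𝟙{a₀² + ρ² < 1}·F(a₀, ρ²) dρ)`. [folklore] -/
theorem lintegral_coneMeasure_re_normSqIm (F : ℝ → ℝ → ℝ≥0∞) (hF : Measurable (Function.uncurry F)) :
    ∫⁻ a, F a.re (‖a.im‖ ^ 2) ∂coneMeasure =
      ENNReal.ofReal coneConst * ∫⁻ r : ℝ, ENNReal.ofReal (4 * Real.pi) *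
        ∫⁻ ρ in Ioi (0 : ℝ), ENNReal.ofReal (ρ ^ 2) * {q : ℝ × ℝ | q.1 ^ 2 + q.2 < 1}.indicator (fun q => F q.1 q.2) (r, ρ ^ 2) := by
  rw [lintegral_coneMeasure_eq]
  congr 1
  have e : (fun a : ℍ => (Metric.ball (0 : ℍ) 1).indicator (fun a => F a.re (‖a.im‖ ^ 2)) a) = fun a => coneCoordFun F (quatReImEquiv a) :=
    funext (ball_indicator_eq_coneCoordFun F)
  rw [e, measurePreserving_quatReImEquiv.lintegral_comp (measurable_coneCoordFun hF),
    show (volume : Measure (ℝ × (Fin 3 → ℝ))) = (volume : Measure ℝ).prod (volume : Measure (Fin 3 → ℝ)) from rfl,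
    lintegral_prod _ (measurable_coneCoordFun hF).aemeasurable]
  refine lintegral_congr fun r => ?_
  have hf : Measurable fun s : ℝ => {q : ℝ × ℝ | q.1 ^ 2 + q.2 < 1}.indicator (fun q => F q.1 q.2) (r, s) :=
    (Measurable.indicator hF (measurableSet_lt ((measurable_fst.pow_const 2).add measurable_snd) measurable_const)).comp measurable_prodMk_left
  exact lintegral_chart_radial (fun s : ℝ => {q : ℝ × ℝ | q.1 ^ 2 + q.2 < 1}.indicator (fun q => F q.1 q.2) (r, s)) hf

/-- The same with the cut-off written on `ρ`: `∫ F(a₀, ‖Im a‖²) dcone = coneConst·∫ da₀ 4π ∫_{ρ>0} 𝟙{a₀² + ρ² < 1}·ρ²·F(a₀, ρ²) dρ`. [folklore] -/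
theorem lintegral_coneMeasure_re_normSqIm' (F : ℝ → ℝ → ℝ≥0∞) (hF : Measurable (Function.uncurry F)) :
    ∫⁻ a, F a.re (‖a.im‖ ^ 2) ∂coneMeasure =
      ENNReal.ofReal coneConst * ∫⁻ r : ℝ, ENNReal.ofReal (4 * Real.pi) *
        ∫⁻ ρ in Ioi (0 : ℝ), {ρ : ℝ | r ^ 2 + ρ ^ 2 < 1}.indicator (fun ρ => ENNReal.ofReal (ρ ^ 2) * F r (ρ ^ 2)) ρ := by
  rw [lintegral_coneMeasure_re_normSqIm F hF]
  congr 1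
  refine lintegral_congr fun r => ?_
  congr 1
  refine lintegral_congr fun ρ => ?_
  by_cases h : r ^ 2 + ρ ^ 2 < 1
  · rw [Set.indicator_of_mem (show (r, ρ ^ 2) ∈ {q : ℝ × ℝ | q.1 ^ 2 + q.2 < 1} from h), Set.indicator_of_mem (show ρ ∈ {ρ : ℝ | r ^ 2 + ρ ^ 2 < 1} from h)]
  · rw [Set.indicator_of_notMem (show (r, ρ ^ 2) ∉ {q : ℝ × ℝ | q.1 ^ 2 + q.2 < 1} from h),
      Set.indicator_of_notMem (show ρ ∉ {ρ : ℝ | r ^ 2 + ρ ^ 2 < 1} from h), mul_zero]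

/-- ★ **Total mass check**: with `F ≡ 1`, `1 = coneConst·∫ da₀ 4π ∫_{ρ>0} 𝟙{a₀² + ρ² < 1} ρ² dρ` — the normalisation of the cone measure in radial form
(a consistency test of the disintegration; no value of `coneConst` is used). [folklore] -/
theorem coneConst_radial_mass :
    ENNReal.ofReal coneConst * ∫⁻ r : ℝ, ENNReal.ofReal (4 * Real.pi) *
        ∫⁻ ρ in Ioi (0 : ℝ), {ρ : ℝ | r ^ 2 + ρ ^ 2 < 1}.indicator (fun ρ => ENNReal.ofReal (ρ ^ 2) * 1) ρ = 1 := by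
  haveI := isProbabilityMeasure_coneMeasure
  have h := lintegral_coneMeasure_re_normSqIm' (fun _ _ => (1 : ℝ≥0∞)) measurable_const
  rw [lintegral_const, measure_univ, mul_one] at h
  exact h.symm

end Summit.QuantumFields.YangMills.Theorems.SwapVirialDeficit.ZeroModeGroup

end
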